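import Literature.NumberTheory.GaloisRepresentations.RestrictedRamificationInflationKernelPrimePower
import Literature.NumberTheory.GaloisRepresentations.BrauerTower
import HarnessLib

/-!
# `ker(inf²)` dies under `μ_{p^a} ↪ μ_{p^{a+t}}` — ONE STAGE DOWN: from «the restriction to
# `T ≤ H` of the inflation of `[f]` vanishes» to the coboundary on `Gal(K_S/K̄^T)`

Third file of the `RestrictedRamificationInflationKernel` group (step (B) of the cyclotomic weak
Leopoldt route, Neukirch–Schmidt–Wingberg (10.3.25) via (8.3.11) (ii)).  The Brauer-killing step (A)
of that route (tree `CyclotomicKillingPrimePower.exists_forall_resSub_mu_primePow_eq_zero_of_le_layerSubgroup`)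
does not make the inflation of a stage class `[f] ∈ H²(Gal(K_S/F_k), μ_{p^a})` vanish on
`H = Gal(K̄/F_k)` itself, but only its RESTRICTION to a deeper closed `T = Gal(K̄/F_{k'}) ≤ H`
(`resSub (mu K (p^a)) hTH 2 (infl_H [f]) = 0`).  This file performs the bookkeeping between that
output and the input of `RestrictedRamificationInflationKernel{,PrimePower}` at the level `T`:

* `galoisGroupAbove_mono` / `exists_restrict_descended` — restriction of a descended action `ρG` of
  `Gal(K_S/F) = galoisGroupAbove S H` and of a `2`-cocycle `f` along
  `galoisGroupAbove S T ≤ galoisGroupAbove S H` (tree `inclHom`), with the action / value formulas;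
* `exists_oneCochain_of_resSub_inflation_eq_zero` — if `resSub (mu K N) hTH 2 (infl_H [f]) = 0` for an
  inflation map `infl_H` computed on cocycles (`exists_inflation₂`), then
  `f(q_H σ, q_H τ) = σ·φ(τ) − φ(στ) + φ(σ)` for a continuous `φ : T → μ_N` and all `σ, τ ∈ T`
  (`map_twoCocycleClass` for `resSub` + `twoCocycleClass_eq_zero_iff` on the compact `T`);
* **`exists_twoCoboundary_stage_of_resSub_inflation_eq_zero`** — `K` a number field, `S ⊇ {v ∣ p}`,
  `N_S ≤ T ≤ H` closed, `ρG` descended on `μ_{p^a}`, `f`, `infl_H`, the vanishing above, and radical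
  descent (RD) FOR `K̄^T` at `(p^a, p^{a+t})` (uniform `t`, units of `K̄` — the shape of the tree's
  `radicalDescent_of_isOpen`, `UnramifiedRadicalDescentOpen.lean`, for `T` open) ⟹ a continuous
  `b : galoisGroupAbove S T → μ_{p^{a+t}}` with `ι(f(q_H σ, q_H τ)) = σ·b(q_T τ) − b(q_T(στ)) + b(q_T σ)`
  for all `σ, τ ∈ T` ((KUM) and «`N_S` fixes `μ_{p^{a+t}}`» discharged by the tree's
  `RestrictedRamificationKummer`).

HONEST FRAMING: cochain plumbing; (RD) is a hypothesis; nothing arithmetic is asserted.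

## References

* J. Neukirch, A. Schmidt, K. Wingberg, *Cohomology of Number Fields*, 2nd ed. (2008), (1.5.1)
  (restriction / inflation functoriality), (8.3.11) (ii), (10.3.25). [NeukirchSchmidtWingberg2008]
* J.-P. Serre, *Galois Cohomology* (1997), I §2.4 (compatible pairs), I §2.6 (b). [SerreGaloisCohomology1997]
-/

noncomputable section

open CategoryTheory Function Topology Field NumberField IsDedekindDomain

namespace Literature.NumberTheory.GaloisRepresentations

open _root_.TopRep _root_.ContRepresentation _root_.ContinuousCohomology DiscreteGaloisModule
open Literature.NumberTheory.IwasawaTheory.Greenberg2006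

variable {K : Type} [Field K] [NumberField K] (S : Set (HeightOneSpectrum (𝓞 K)))
  {T H : Subgroup (absoluteGaloisGroup K)}

/-! ### §1. Restriction along `galoisGroupAbove S T ≤ galoisGroupAbove S H` -/

omit [NumberField K] in
/-- `T ≤ H ⟹ Gal(K_S/K̄^T) ≤ Gal(K_S/K̄^H)` inside `G_{K,S}`. [cite: Greenberg2006, p. 342]
[cite: NeukirchSchmidtWingberg2008, VIII §3] -/
theorem galoisGroupAbove_mono (hTH : T ≤ H) : galoisGroupAbove S T ≤ galoisGroupAbove S H :=
  Subgroup.map_mono hTH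

omit [NumberField K] in
/-- The inclusion `galoisGroupAbove S T → galoisGroupAbove S H` sends `q_T σ` to `q_H σ` (`σ ∈ T`). [cite: Greenberg2006, p. 342] -/
theorem inclHom_galoisGroupAbove_mk (hTH : T ≤ H) (σ : T) :
    inclHom (galoisGroupAbove_mono S hTH)
        ⟨toUnramifiedQuot K S (σ : absoluteGaloisGroup K), coe_mem_galoisGroupAbove S T σ⟩ =
      ⟨toUnramifiedQuot K S ((⟨σ, hTH σ.2⟩ : H) : absoluteGaloisGroup K), coe_mem_galoisGroupAbove S H ⟨σ, hTH σ.2⟩⟩ :=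
  rfl

variable {N : ℕ}

omit [NumberField K] in
/-- **Restriction of descended data one stage down.**  A descended action `ρG` of `Gal(K_S/K̄^H)` on `μ_N`
and a continuous `2`-cocycle `f` restrict along `Gal(K_S/K̄^T) ≤ Gal(K_S/K̄^H)` to a descended action
`ρT` of `Gal(K_S/K̄^T)` and a `2`-cocycle `fT` with `fT(q_T σ, q_T τ) = f(q_H σ, q_H τ)` (`σ, τ ∈ T`).
[cite: SerreGaloisCohomology1997, I §2.4] [cite: NeukirchSchmidtWingberg2008, (1.5.1)] -/
theorem exists_restrict_descended (hTH : T ≤ H) (ρG : ContinuousRep (galoisGroupAbove S H) ℤ (MuCarrier K N))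
    (hρG : ∀ (σ : H) (v : MuCarrier K N),
      ρG ⟨toUnramifiedQuot K S (σ : absoluteGaloisGroup K), coe_mem_galoisGroupAbove S H σ⟩ v =
        mu K N (σ : absoluteGaloisGroup K) v)
    (f : contTwoCocycles ρG.toTopRep) :
    ∃ (ρT : ContinuousRep (galoisGroupAbove S T) ℤ (MuCarrier K N)) (fT : contTwoCocycles ρT.toTopRep),
      (∀ (σ : T) (v : MuCarrier K N),
        ρT ⟨toUnramifiedQuot K S (σ : absoluteGaloisGroup K), coe_mem_galoisGroupAbove S T σ⟩ v =
          mu K N (σ : absoluteGaloisGroup K) v) ∧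
      ∀ σ τ : T, fT.1 (⟨toUnramifiedQuot K S (σ : absoluteGaloisGroup K), coe_mem_galoisGroupAbove S T σ⟩,
          ⟨toUnramifiedQuot K S (τ : absoluteGaloisGroup K), coe_mem_galoisGroupAbove S T τ⟩) =
        f.1 (⟨toUnramifiedQuot K S ((⟨σ, hTH σ.2⟩ : H) : absoluteGaloisGroup K), coe_mem_galoisGroupAbove S H ⟨σ, hTH σ.2⟩⟩,
          ⟨toUnramifiedQuot K S ((⟨τ, hTH τ.2⟩ : H) : absoluteGaloisGroup K), coe_mem_galoisGroupAbove S H ⟨τ, hTH τ.2⟩⟩) := by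
  let θ : galoisGroupAbove S T →ₜ* galoisGroupAbove S H := inclHom (galoisGroupAbove_mono S hTH)
  let ι : TopRep.res (θ : galoisGroupAbove S T →* galoisGroupAbove S H) ρG.toTopRep ⟶ (ρG.restrict θ).toTopRep :=
    TopRep.ofHom ⟨ContinuousLinearMap.id ℤ (MuCarrier K N), fun _ => rfl⟩
  refine ⟨ρG.restrict θ, contTwoCocycles.pullback θ ι f, fun σ v => ?_, fun σ τ => rfl⟩
  rw [ContinuousRep.restrict_apply]
  exact hρG ⟨σ, hTH σ.2⟩ v

/-! ### §2. From `res_T (inf_H [f]) = 0` to a splitting cochain on `T` -/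

/-- **A splitting cochain one stage down.**  If the restriction to the closed `T ≤ H` of the inflation
`infl_H [f] ∈ H²(H, μ_N)` vanishes (`infl_H` any additive map computed on cocycles by composition with
`q_H × q_H`), then `f(q_H σ, q_H τ) = σ·φ(τ) − φ(στ) + φ(σ)` for a continuous `φ : T → μ_N` and all
`σ, τ ∈ T`. [cite: SerreGaloisCohomology1997, I §2.3–§2.4] [cite: NeukirchSchmidtWingberg2008, (1.5.1)] -/
theorem exists_oneCochain_of_resSub_inflation_eq_zero (hTH : T ≤ H)
    (hT : IsClosed (T : Set (absoluteGaloisGroup K))) (hH : IsClosed (H : Set (absoluteGaloisGroup K)))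
    (ρG : ContinuousRep (galoisGroupAbove S H) ℤ (MuCarrier K N))
    (hρG : ∀ (σ : H) (v : MuCarrier K N),
      ρG ⟨toUnramifiedQuot K S (σ : absoluteGaloisGroup K), coe_mem_galoisGroupAbove S H σ⟩ v =
        mu K N (σ : absoluteGaloisGroup K) v)
    (f : contTwoCocycles ρG.toTopRep) :
    haveI : CompactSpace (galoisGroupAbove S H) := compactSpace_galoisGroupAbove S H hH
    ∀ (infl : (continuousCohomology 2 ρG.toTopRep : Type) →+
        (continuousCohomology 2 ((mu K N).restrict (subgroupIncl H)).toTopRep : Type)),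
      (∀ (f : contTwoCocycles ρG.toTopRep) (F : contTwoCocycles ((mu K N).restrict (subgroupIncl H)).toTopRep),
        (∀ σ τ : H, F.1 (σ, τ) =
          f.1 (⟨toUnramifiedQuot K S (σ : absoluteGaloisGroup K), coe_mem_galoisGroupAbove S H σ⟩,
            ⟨toUnramifiedQuot K S (τ : absoluteGaloisGroup K), coe_mem_galoisGroupAbove S H τ⟩)) →
        infl (twoCocycleClass _ f) = twoCocycleClass _ F) →
      resSub (mu K N) hTH 2 (infl (twoCocycleClass _ f)) = 0 →
      ∃ φ : C(T, MuCarrier K N), ∀ σ τ : T,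
        f.1 (⟨toUnramifiedQuot K S ((⟨σ, hTH σ.2⟩ : H) : absoluteGaloisGroup K), coe_mem_galoisGroupAbove S H ⟨σ, hTH σ.2⟩⟩,
            ⟨toUnramifiedQuot K S ((⟨τ, hTH τ.2⟩ : H) : absoluteGaloisGroup K), coe_mem_galoisGroupAbove S H ⟨τ, hTH τ.2⟩⟩) =
          mu K N (σ : absoluteGaloisGroup K) (φ τ) - φ (σ * τ) + φ σ := by
  haveI : CompactSpace (absoluteGaloisGroup K) := absoluteGaloisGroup_compactSpace K
  haveI : CompactSpace H := isCompact_iff_compactSpace.mp hH.isCompact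
  haveI : CompactSpace T := isCompact_iff_compactSpace.mp hT.isCompact
  haveI : CompactSpace (galoisGroupAbove S H) := compactSpace_galoisGroupAbove S H hH
  intro infl hinfl hres
  obtain ⟨F, hF⟩ := exists_twoCocycle_inflate S H ρG hρG f
  rw [hinfl f F hF, map_twoCocycleClass, twoCocycleClass_eq_zero_iff] at hres
  obtain ⟨φ, hφ⟩ := hres
  refine ⟨φ, fun σ τ => ?_⟩
  have h := hφ σ τ
  rw [contTwoCocycles.pullback_apply, resSubMod_hom_apply, inclHom_apply, inclHom_apply, hF,
    ContinuousRep.toTopRep_ρ_apply, ContinuousRep.restrict_apply, subgroupIncl_apply] at h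
  exact h

/-! ### §3. The stage theorem -/

/-- **`ker(inf²)` dies one stage down.**  `K` a number field, `S ⊇ {v ∣ p}`, `N_S ≤ T ≤ H` closed
subgroups of `Γ_K` (`K̄^H ⊆ K̄^T ⊆ K_S`), `ρG` a descended action of `Gal(K_S/K̄^H)` on `μ_{p^a}`,
`f` a continuous `2`-cocycle whose inflation to `H` VANISHES AFTER RESTRICTION TO `T` (the output of
the cyclotomic Brauer-killing step), and radical descent (RD) for `K̄^T` inside `K_S` at `(p^a, p^{a+t})`
(units of `K̄`, uniform `t`: the tree's `radicalDescent_of_isOpen` for `T` open).  Then there is a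
continuous `b : Gal(K_S/K̄^T) → μ_{p^{a+t}}` with `ι(f(q_H σ, q_H τ)) = σ·b(q_T τ) − b(q_T(στ)) + b(q_T σ)`
for all `σ, τ ∈ T`. [cite: NeukirchSchmidtWingberg2008, (8.3.11) (ii), (10.3.25)] [cite: Serre1979, Ch. X §3 b)] -/
theorem exists_twoCoboundary_stage_of_resSub_inflation_eq_zero {p : ℕ} [Fact p.Prime]
    (hS : ∀ v : HeightOneSpectrum (𝓞 K), ((p : ℕ) : 𝓞 K) ∈ v.asIdeal → v ∈ S) (hTH : T ≤ H)
    (hT : IsClosed (T : Set (absoluteGaloisGroup K))) (hH : IsClosed (H : Set (absoluteGaloisGroup K)))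
    (hNT : ramificationSubgroup K S ≤ T) {a t : ℕ}
    (hRD : ∀ b : (AlgebraicClosure K)ˣ, (∀ n ∈ ramificationSubgroup K S, n • b = b) →
      (∀ σ ∈ T, ∃ d : (AlgebraicClosure K)ˣ,
        (∀ n ∈ ramificationSubgroup K S, n • d = d) ∧ σ • b = b * d ^ p ^ a) →
      ∃ c d : (AlgebraicClosure K)ˣ, (∀ σ ∈ T, σ • c = c) ∧ (∀ n ∈ ramificationSubgroup K S, n • d = d) ∧
        b ^ p ^ t = c * d ^ p ^ (a + t))
    (ρG : ContinuousRep (galoisGroupAbove S H) ℤ (MuCarrier K (p ^ a)))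
    (hρG : ∀ (σ : H) (v : MuCarrier K (p ^ a)),
      ρG ⟨toUnramifiedQuot K S (σ : absoluteGaloisGroup K), coe_mem_galoisGroupAbove S H σ⟩ v =
        mu K (p ^ a) (σ : absoluteGaloisGroup K) v)
    (f : contTwoCocycles ρG.toTopRep) :
    haveI : CompactSpace (galoisGroupAbove S H) := compactSpace_galoisGroupAbove S H hH
    ∀ (infl : (continuousCohomology 2 ρG.toTopRep : Type) →+
        (continuousCohomology 2 ((mu K (p ^ a)).restrict (subgroupIncl H)).toTopRep : Type)),
      (∀ (f : contTwoCocycles ρG.toTopRep)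
          (F : contTwoCocycles ((mu K (p ^ a)).restrict (subgroupIncl H)).toTopRep),
        (∀ σ τ : H, F.1 (σ, τ) =
          f.1 (⟨toUnramifiedQuot K S (σ : absoluteGaloisGroup K), coe_mem_galoisGroupAbove S H σ⟩,
            ⟨toUnramifiedQuot K S (τ : absoluteGaloisGroup K), coe_mem_galoisGroupAbove S H τ⟩)) →
        infl (twoCocycleClass _ f) = twoCocycleClass _ F) →
      resSub (mu K (p ^ a)) hTH 2 (infl (twoCocycleClass _ f)) = 0 →
      ∃ b : C(galoisGroupAbove S T, MuCarrier K (p ^ (a + t))), ∀ σ τ : T,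
        muInclusion K (pow_dvd_pow p (Nat.le_add_right a t))
            (f.1 (⟨toUnramifiedQuot K S ((⟨σ, hTH σ.2⟩ : H) : absoluteGaloisGroup K),
                coe_mem_galoisGroupAbove S H ⟨σ, hTH σ.2⟩⟩,
              ⟨toUnramifiedQuot K S ((⟨τ, hTH τ.2⟩ : H) : absoluteGaloisGroup K),
                coe_mem_galoisGroupAbove S H ⟨τ, hTH τ.2⟩⟩)) =
          mu K (p ^ (a + t)) (σ : absoluteGaloisGroup K)
              (b ⟨toUnramifiedQuot K S (τ : absoluteGaloisGroup K), coe_mem_galoisGroupAbove S T τ⟩) -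
            b ⟨toUnramifiedQuot K S ((σ * τ : T) : absoluteGaloisGroup K), coe_mem_galoisGroupAbove S T (σ * τ)⟩ +
            b ⟨toUnramifiedQuot K S (σ : absoluteGaloisGroup K), coe_mem_galoisGroupAbove S T σ⟩ := by
  have hp : p.Prime := Fact.out
  haveI : NeZero (p ^ a) := ⟨pow_ne_zero _ hp.ne_zero⟩
  intro infl hinfl hres
  -- the splitting cochain on `T` and the restricted data
  obtain ⟨φ, hφ⟩ := exists_oneCochain_of_resSub_inflation_eq_zero S hTH hT hH ρG hρG f infl hinfl hres
  obtain ⟨ρT, fT, hρT, hfT⟩ := exists_restrict_descended S hTH ρG hρG f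
  have hφT : ∀ σ τ : T,
      fT.1 (⟨toUnramifiedQuot K S (σ : absoluteGaloisGroup K), coe_mem_galoisGroupAbove S T σ⟩,
          ⟨toUnramifiedQuot K S (τ : absoluteGaloisGroup K), coe_mem_galoisGroupAbove S T τ⟩) =
        mu K (p ^ a) (σ : absoluteGaloisGroup K) (φ τ) - φ (σ * τ) + φ σ := fun σ τ => by
    rw [hfT]; exact hφ σ τ
  -- (KUM) and «`N_S` fixes `μ_{p^{a+t}}`» from the tree
  have hKUM : ∀ x : contOneCocycles
      ((mu K (p ^ a)).restrict (subgroupIncl (ramificationSubgroup K S))).toTopRep,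
      ∃ β : (AlgebraicClosure K)ˣ, ∀ n : ramificationSubgroup K S,
        muVal K (p ^ a) (x.1 n) = (n : absoluteGaloisGroup K) • β / β := fun x => by
    obtain ⟨β, -, h⟩ := ramificationSubgroup.exists_kummer_eq_contOneCocycle K S (p ^ a) x
    exact ⟨β, h⟩
  have hS' : ∀ v : HeightOneSpectrum (𝓞 K), ((p ^ (a + t) : ℕ) : 𝓞 K) ∈ v.asIdeal → v ∈ S := fun v hv => by
    rw [Nat.cast_pow] at hv
    exact hS v (v.isPrime.mem_of_pow_mem _ hv)
  have htriv' : ∀ n ∈ ramificationSubgroup K S, ∀ v : MuCarrier K (p ^ (a + t)),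
      mu K (p ^ (a + t)) n v = v := by
    intro n hn v
    apply muVal_injective K (p ^ (a + t))
    rw [muVal_apply]
    refine Units.ext ?_
    rw [Units.coe_smul]
    exact smul_units_eq_self_of_mem_ramificationSubgroup hS' _ (muVal_pow_eq_one K _ v) n hn
  -- (B) at the level `T`
  obtain ⟨b, hb⟩ := exists_twoCoboundary_of_radicalDescent_of_kummer' S T hT hNT (pow_add p a t).symm hRD hKUM
    htriv' ρT hρT fT φ hφT
  refine ⟨b, fun σ τ => ?_⟩
  rw [← hfT σ τ]
  exact hb σ τ

end Literature.NumberTheory.GaloisRepresentations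

end
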